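import Summits.QuantumFields.YangMills.Theorems.ConvexGribovBodyContinuumLegGivenGapCsclScheme
import Summits.QuantumFields.YangMills.Theorems.ConvexGribovBodyContinuumLegGivenGapStubOsMatching
import HarnessLib

/-!
# `ContinuumLegGivenGap` (stmt-QuantumFields-15828), line `Sketch`, reshape 17-CS, helper 9 of `stub_csclOfLock`:
# the lattice representative of a test function at one step of a scheme — decomposition into two local species
# with the class support, sup bounds, cylinder/measurability data, exact lattice translation

With `X_F(V) = ∑ₓ F(a_k x⃗) ∏ᵢ (P(τ_{xᵢ}V) − ⟨P⟩_k)` (so that route ParabolicTrajectory's `Arp.lat sch k (cen P) F U = X_F(Ũ)`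
by `rfl`): if every tuple `x⃗` with `F(a_k x⃗) ≠ 0` has coordinates `|xᵢⱼ| ≤ Nk` and times `xᵢ₀ ≥ Rc + 2` (`Rc` a
coordinate bound of the curvature support), then `X_F = O₁ + i O₂` with local gauge-invariant REAL observables
`O₁, O₂` of support EXACTLY the class box `Λ = {e : |e.1 j| ≤ Nk + Rc, 1 ≤ e.1 0}` and
`|Oⱼ| ≤ (#box Nk)ⁿ ‖F‖∞ (2C_P)ⁿ` (`cscl_rep_decomp`); consequently `X_F` is a bounded measurable cylinder on `Λ`
(`cscl_rep_cylinder`). Exact lattice translation: `X_{T_{a_k s e₀} H} = X_H ∘ τˢ` once the translated time support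
still fits the box (`cscl_rep_translate`). Registered anchor: `cscl_anchor_rep`. No definitions. [folklore]
-/

noncomputable section

open scoped SchwartzMap ComplexConjugate
open MeasureTheory Filter Topology
open Literature.MathematicalPhysics.QuantumFieldTheory Literature.MathematicalPhysics.QuantumLattice
  Literature.MathematicalPhysics.AQFT
open Literature.Probability.LatticeModels (box mem_box Site)
open Summit.QuantumFields.YangMills.Theorems.ClusteringToYangMills.Reconstructible
open Summit.QuantumFields.YangMills.Cruxes.ContinuumLimitOnTrajectory.TwoOrbitSynchronisation (Arp.sum_boxFun_eq)

namespace Summit.QuantumFields.YangMills.Theorems.ContinuumLegGivenGap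

section Rep

variable {G : Type} [Group G] [TopologicalSpace G] [IsTopologicalGroup G] [CompactSpace G]
  [MeasurableSpace G] [BorelSpace G] (r : LatticeRep G) (sch : SpeciesScheme (YMSpecies G)) (k : ℕ)

/-- The torus mean of a bounded observable is bounded by the same constant. [folklore] -/
theorem cscl_abs_wilsonTorusMean_le {P : LGConfig 4 G → ℝ} {CP : ℝ} (hCP : ∀ U, |P U| ≤ CP)
    (β : ℝ) (L : ℕ) : |wilsonTorusMean r.ρ β L P| ≤ CP := by
  haveI := isProbabilityMeasure_wilsonMeasure (d := 4) (L := 2 * L + 1) r.ρ r.continuous β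
  unfold wilsonTorusMean
  have h := norm_integral_le_of_norm_le_const (μ := wilsonMeasure (d := 4) (L := 2 * L + 1) r.ρ β)
    (f := fun U => P (torusLift (2 * L + 1) U)) (C := CP) (Eventually.of_forall fun U => by
      rw [Real.norm_eq_abs]; exact hCP _)
  simpa [Real.norm_eq_abs] using h

/-- **Decomposition of the representative into two local species with the class support and sup bounds.**
[folklore] -/
theorem cscl_rep_decomp {n Nk Rc : ℕ} {NF CP : ℝ} (hNF : 0 ≤ NF) (hCP : ∀ U, |r.curvature.F U| ≤ CP)
    (hRc : ∀ e ∈ r.curvature.supp, ∀ j : Fin 4, |e.1 j| ≤ Rc)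
    (F : 𝓢((Fin n → EuclideanSpace ℝ (Fin 4)), ℂ)) (hFb : ∀ y, ‖F y‖ ≤ NF)
    (hcls : ∀ x : Fin n → Site 4, F (fun i => sch.a k • siteToE (x i)) ≠ 0 →
      (∀ i j, |x i j| ≤ Nk) ∧ ∀ i, (Rc : ℤ) + 2 ≤ x i 0) :
    ∃ O₁ O₂ : YMSpecies G,
      O₁.supp = ((box 4 (Nk + Rc)).filter fun y => 1 ≤ y 0) ×ˢ (Finset.univ : Finset (Fin 4)) ∧
      O₂.supp = ((box 4 (Nk + Rc)).filter fun y => 1 ≤ y 0) ×ˢ (Finset.univ : Finset (Fin 4)) ∧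
      (∀ V : LGConfig 4 G,
        (∑ x : Fin n → ↥(box 4 (sch.L k)), F (fun i => sch.a k • siteToE (↑(x i) : Site 4)) *
          ∏ i, ((r.curvature.F (configShift (-(↑(x i) : Site 4)) V) -
            wilsonTorusMean r.ρ (sch.β k) (sch.L k) r.curvature.F : ℝ) : ℂ)) =
        (O₁.F V : ℂ) + Complex.I * (O₂.F V : ℂ)) ∧
      (∀ V, |O₁.F V| ≤ ((box 4 Nk).card : ℝ) ^ n * NF * (2 * CP) ^ n) ∧
      (∀ V, |O₂.F V| ≤ ((box 4 Nk).card : ℝ) ^ n * NF * (2 * CP) ^ n) := by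
  classical
  set a : ℝ := sch.a k
  set mb : ℝ := wilsonTorusMean r.ρ (sch.β k) (sch.L k) r.curvature.F
  set B : Finset (Fin n → Site 4) := Fintype.piFinset fun _ : Fin n => box 4 (sch.L k)
  set Λ : Finset (Literature.MathematicalPhysics.QuantumLattice.ZdEdge 4) :=
    ((box 4 (Nk + Rc)).filter fun y => 1 ≤ y 0) ×ˢ (Finset.univ : Finset (Fin 4))
  -- support condition for both weight choices
  have hΛ : ∀ (wt : (Fin n → Site 4) → ℝ), (∀ x, F (fun i => a • siteToE (x i)) = 0 → wt x = 0) →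
      ∀ x ∈ B, wt x ≠ 0 → ∀ i, ∀ e ∈ r.curvature.supp, (e.1 + x i, e.2) ∈ Λ := by
    intro wt hwt x _ hx i e he
    have hF : F (fun i => a • siteToE (x i)) ≠ 0 := fun h0 => hx (hwt x h0)
    obtain ⟨hc, ht⟩ := hcls x hF
    simp only [Λ, Finset.mem_product, Finset.mem_filter, mem_box, Finset.mem_univ, and_true, Pi.add_apply]
    refine ⟨fun j => ?_, ?_⟩
    · have h1 := abs_le.1 (hRc e he j)
      have h2 := abs_le.1 (hc i j)
      constructor <;> push_cast <;> omega
    · have h1 := abs_le.1 (hRc e he 0)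
      have h2 := ht i
      omega
  obtain ⟨O₁, hO₁F, hO₁s⟩ := cscl_rep_species r.curvature B (fun x => (F (fun i => a • siteToE (x i))).re) mb
    (hΛ _ fun x h0 => by simp [h0])
  obtain ⟨O₂, hO₂F, hO₂s⟩ := cscl_rep_species r.curvature B (fun x => (F (fun i => a • siteToE (x i))).im) mb
    (hΛ _ fun x h0 => by simp [h0])
  -- the sup bounds
  have hmb : |mb| ≤ CP := cscl_abs_wilsonTorusMean_le r hCP _ _
  have hsum : ∀ (wt : (Fin n → Site 4) → ℝ), (∀ x, |wt x| ≤ ‖F (fun i => a • siteToE (x i))‖) →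
      ∑ x ∈ B, |wt x| ≤ ((box 4 Nk).card : ℝ) ^ n * NF := by
    intro wt hwt
    have hvan : ∀ x ∈ B, x ∉ Fintype.piFinset (fun _ : Fin n => box 4 Nk) → |wt x| = 0 := by
      intro x _ hx
      have : F (fun i => a • siteToE (x i)) = 0 := by
        by_contra hF
        refine hx (Fintype.mem_piFinset.2 fun i => mem_box.2 fun j => abs_le.1 ((hcls x hF).1 i j))
      have h := hwt x
      rw [this, norm_zero] at h
      exact le_antisymm h (abs_nonneg _)
    calc ∑ x ∈ B, |wt x| = ∑ x ∈ B ∩ Fintype.piFinset (fun _ : Fin n => box 4 Nk), |wt x| :=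
          (Finset.sum_subset Finset.inter_subset_left fun x hxB hxn =>
            hvan x hxB fun hm => hxn (Finset.mem_inter.2 ⟨hxB, hm⟩)).symm
      _ ≤ ∑ _x ∈ B ∩ Fintype.piFinset (fun _ : Fin n => box 4 Nk), NF :=
          Finset.sum_le_sum fun x _ => (hwt x).trans (hFb _)
      _ = ((B ∩ Fintype.piFinset (fun _ : Fin n => box 4 Nk)).card : ℝ) * NF := by
          rw [Finset.sum_const, nsmul_eq_mul]
      _ ≤ ((Fintype.piFinset (fun _ : Fin n => box 4 Nk)).card : ℝ) * NF := by
          gcongr; exact Finset.inter_subset_right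
      _ = ((box 4 Nk).card : ℝ) ^ n * NF := by
          rw [Fintype.card_piFinset, Finset.prod_const, Finset.card_univ, Fintype.card_fin]; push_cast; ring
  have hCP0 : 0 ≤ CP := (abs_nonneg _).trans (hCP (Classical.arbitrary _))
  have hbound : ∀ (wt : (Fin n → Site 4) → ℝ), (∀ x, |wt x| ≤ ‖F (fun i => a • siteToE (x i))‖) →
      ∀ V : LGConfig 4 G, |∑ x ∈ B, wt x * ∏ i, (r.curvature.F (configShift (-(x i)) V) - mb)| ≤
        ((box 4 Nk).card : ℝ) ^ n * NF * (2 * CP) ^ n := by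
    intro wt hwt V
    refine (cscl_rep_bounded r.curvature B wt mb hCP V).trans ?_
    have h1 := hsum wt hwt
    have h2 : (CP + |mb|) ^ n ≤ (2 * CP) ^ n := pow_le_pow_left₀ (by positivity) (by linarith) n
    have h3 : 0 ≤ ∑ x ∈ B, |wt x| := Finset.sum_nonneg fun x _ => abs_nonneg _
    calc (∑ x ∈ B, |wt x|) * (CP + |mb|) ^ n ≤ (((box 4 Nk).card : ℝ) ^ n * NF) * (2 * CP) ^ n :=
          mul_le_mul h1 h2 (by positivity) (by positivity)
      _ = _ := by ring
  refine ⟨O₁, O₂, hO₁s, hO₂s, fun V => ?_, fun V => ?_, fun V => ?_⟩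
  · rw [hO₁F, hO₂F]
    have hs := Arp.sum_boxFun_eq (L := sch.L k) (fun y : Fin n → Site 4 =>
      F (fun i => a • siteToE (y i)) * ∏ i, ((r.curvature.F (configShift (-(y i)) V) - mb : ℝ) : ℂ))
    simp only at hs
    rw [hs]
    push_cast
    rw [Finset.mul_sum, ← Finset.sum_add_distrib]
    refine Finset.sum_congr rfl fun x _ => ?_
    rw [← Complex.re_add_im (F fun i => a • siteToE (x i))]
    simp only [Complex.add_re, Complex.ofReal_re, Complex.mul_re, Complex.I_re, zero_mul, Complex.ofReal_im,
      mul_zero, sub_zero, Complex.I_im, add_zero, Complex.add_im, Complex.mul_im, zero_add]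
    push_cast
    ring
  · rw [hO₁F]; exact hbound _ (fun x => Complex.abs_re_le_norm _) V
  · rw [hO₂F]; exact hbound _ (fun x => Complex.abs_im_le_norm _) V

end Rep

/-- **Registered anchor of this file** (closed form of `cscl_abs_wilsonTorusMean_le`, for the gate's `--supports`
stub check). [folklore] -/
theorem cscl_anchor_rep :
    ∀ (G : Type) [Group G] [TopologicalSpace G] [IsTopologicalGroup G] [CompactSpace G] [MeasurableSpace G]
      [BorelSpace G] (r : LatticeRep G) (P : LGConfig 4 G → ℝ) (CP : ℝ), (∀ U, |P U| ≤ CP) →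
      ∀ (β : ℝ) (L : ℕ), |wilsonTorusMean r.ρ β L P| ≤ CP :=
  fun _ _ _ _ _ _ _ r _ _ hCP β L => cscl_abs_wilsonTorusMean_le r hCP β L

end Summit.QuantumFields.YangMills.Theorems.ContinuumLegGivenGap

end
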